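import Mathlib.Algebra.BigOperators.Fin
import Mathlib.Data.Fintype.Perm
import Mathlib.Data.Fintype.Powerset
import Mathlib.GroupTheory.Perm.Basic
import Mathlib.Algebra.Field.Basic
import HarnessLib

/-!
# Potentials for Grenet's branching program: arc weights with constant path products

Topic `Literature/Computability/AlgebraicComplexity`.  Companion of `GrenetWeightedPaths.lean`
(the determinant of a generalised Grenet matrix is the sum over the orderings `σ` of `Fin n` of
the path products `∏ₜ w (σ({i < t})) (σ t)`).  This file is the combinatorics of the PREFIX SETS
`σ({i < t}) = (univ.filter fun i : Fin n => (i : ℕ) < t).image σ` of orderings (the vertices of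
Grenet's branching program visited by the path of `σ`) and the diagonal-gauge normal form of
SCALAR arc weights:

* `Grenet.mem_prefix_image`, `Grenet.card_prefix_image`, `Grenet.not_mem_prefix_image_self`,
  `Grenet.prefix_image_succ`, `Grenet.prefix_image_eq_of_eqOn_lt/ge` — bookkeeping;
* `Grenet.exists_perm_prefix_image_eq`, `Grenet.exists_perm_prefix_image_insert` — every subset
  `S` is a prefix set, and the next element after the prefix `S` can be prescribed;
* `Grenet.prod_prefix_eq_of_prefix_image_eq` — **path independence**: if all FULL path products
  of `ρ` are `1`, a partial path product depends only on the prefix set reached;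
* `Grenet.exists_potential_of_prod_prefix_eq_one` — **potentials**: then `ρ` is a coboundary,
  `ρ S k = μ (insert k S) / μ S` for a nowhere-vanishing potential `μ` on the subsets, i.e. the
  diagonal gauge `diag(μ)⁻¹ · (1 - A) · diag(μ)` normalises every arc scalar to `1`.  This is the
  gauge step in the rigidity of graded Grenet-like determinantal representations of the permanent
  (Landsberg–Ressayre 2017, §6).

## Sources

* Folklore (a 1-cocycle on the Boolean lattice whose holonomy along every maximal chain is
  trivial is a coboundary); used implicitly in J. M. Landsberg, N. Ressayre, *Permanent v.
  determinant: an exponential lower bound assuming symmetry*, Differential Geom. Appl. 55 (2017),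
  §2.2 (vertex scalings of Grenet's graph), §6 (key `LandsbergRessayre2017`).
* B. Grenet, *An upper bound for the permanent versus determinant problem* (2011), Thm. 1 (the
  branching program on the subsets of `Fin n`; key `Grenet2011`).
-/

noncomputable section

open Finset

namespace Literature.Computability.AlgebraicComplexity

namespace Grenet

variable {n : ℕ}

/-! ### Prefix sets of orderings -/

/-- The prefix set `σ({i < j})` of an ordering `σ` of `Fin n` consists of the `x` with `σ⁻¹ x < j`.
[folklore] -/
theorem mem_prefix_image (σ : Equiv.Perm (Fin n)) (j : ℕ) (x : Fin n) :
    x ∈ (univ.filter fun i : Fin n => (i : ℕ) < j).image σ ↔ ((σ.symm x : Fin n) : ℕ) < j := by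
  simp only [mem_image, mem_filter, mem_univ, true_and]
  constructor
  · rintro ⟨i, hi, rfl⟩
    rwa [Equiv.symm_apply_apply]
  · intro h
    exact ⟨σ.symm x, h, Equiv.apply_symm_apply σ x⟩

/-- The prefix set `σ({i < j})` (`j ≤ n`) has `j` elements. [folklore] -/
theorem card_prefix_image (σ : Equiv.Perm (Fin n)) {j : ℕ} (hj : j ≤ n) :
    ((univ.filter fun i : Fin n => (i : ℕ) < j).image σ).card = j := by
  rw [card_image_of_injective _ σ.injective, Fin.card_filter_val_lt, min_eq_right hj]

/-- The `t`-th element of an ordering is new: `σ t ∉ σ({i < t})`. [folklore] -/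
theorem not_mem_prefix_image_self (σ : Equiv.Perm (Fin n)) (t : Fin n) :
    σ t ∉ (univ.filter fun i : Fin n => (i : ℕ) < t).image σ := by
  rw [mem_prefix_image, Equiv.symm_apply_apply]
  exact lt_irrefl _

/-- Growing the prefix: `σ({i < j + 1}) = insert (σ j) (σ({i < j}))`. [folklore] -/
theorem prefix_image_succ (σ : Equiv.Perm (Fin n)) {j : ℕ} (hj : j < n) :
    (univ.filter fun i : Fin n => (i : ℕ) < j + 1).image σ =
      insert (σ ⟨j, hj⟩) ((univ.filter fun i : Fin n => (i : ℕ) < j).image σ) := by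
  have h : (univ.filter fun i : Fin n => (i : ℕ) < j + 1) =
      insert (⟨j, hj⟩ : Fin n) (univ.filter fun i : Fin n => (i : ℕ) < j) := by
    ext i
    simp only [mem_filter, mem_univ, true_and, mem_insert, Fin.ext_iff]
    omega
  rw [h, image_insert]

/-- Two orderings that agree below `j` have the same prefix sets `σ({i < t})` for `t ≤ j`.
[folklore] -/
theorem prefix_image_eq_of_eqOn_lt {σ σ' : Equiv.Perm (Fin n)} {j : ℕ}
    (h : ∀ i : Fin n, (i : ℕ) < j → σ i = σ' i) {t : ℕ} (ht : t ≤ j) :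
    (univ.filter fun i : Fin n => (i : ℕ) < t).image σ =
      (univ.filter fun i : Fin n => (i : ℕ) < t).image σ' :=
  image_congr fun i hi => h i (lt_of_lt_of_le (mem_filter.mp hi).2 ht)

/-- Two orderings (bijections!) that agree from `j` on have the same prefix sets `σ({i < t})` for
`t ≥ j` (the prefix set is the complement of the suffix set). [folklore] -/
theorem prefix_image_eq_of_eqOn_ge {σ σ' : Equiv.Perm (Fin n)} {j : ℕ}
    (h : ∀ i : Fin n, j ≤ (i : ℕ) → σ i = σ' i) {t : ℕ} (ht : j ≤ t) :
    (univ.filter fun i : Fin n => (i : ℕ) < t).image σ =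
      (univ.filter fun i : Fin n => (i : ℕ) < t).image σ' := by
  suffices key : ∀ τ τ' : Equiv.Perm (Fin n), (∀ i : Fin n, j ≤ (i : ℕ) → τ i = τ' i) →
      (univ.filter fun i : Fin n => (i : ℕ) < t).image τ ⊆
        (univ.filter fun i : Fin n => (i : ℕ) < t).image τ' from
    (key σ σ' h).antisymm (key σ' σ fun i hi => (h i hi).symm)
  intro τ τ' hττ' x hx
  rw [mem_prefix_image] at hx ⊢
  by_contra hle'
  have hle := not_lt.mp hle'
  have h1 : τ (τ'.symm x) = x := by rw [hττ' _ (ht.trans hle), Equiv.apply_symm_apply]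
  have h2 : τ.symm x = τ'.symm x := by rw [← h1, Equiv.symm_apply_apply, h1]
  rw [h2] at hx
  exact absurd hx (not_lt.mpr hle)

section Potential

variable {K : Type*} [Field K]

/-- If all full path products are `1`, the partial path products `∏_{t < j} ρ (σ({i < t})) (σ t)` of
two orderings that agree from `j` on coincide (the common suffix product is nonzero and cancels).
[folklore] -/
theorem prod_prefix_eq_of_eqOn_ge (ρ : Finset (Fin n) → Fin n → K)
    (hρ : ∀ σ : Equiv.Perm (Fin n),
      ∏ t : Fin n, ρ ((univ.filter fun i : Fin n => (i : ℕ) < (t : ℕ)).image σ) (σ t) = 1)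
    {σ σ' : Equiv.Perm (Fin n)} {j : ℕ} (h : ∀ i : Fin n, j ≤ (i : ℕ) → σ i = σ' i) :
    ∏ t ∈ univ.filter (fun t : Fin n => (t : ℕ) < j),
        ρ ((univ.filter fun i : Fin n => (i : ℕ) < t).image σ) (σ t) =
      ∏ t ∈ univ.filter (fun t : Fin n => (t : ℕ) < j),
        ρ ((univ.filter fun i : Fin n => (i : ℕ) < t).image σ') (σ' t) := by
  have htail : ∏ t ∈ univ.filter (fun t : Fin n => ¬ (t : ℕ) < j),
        ρ ((univ.filter fun i : Fin n => (i : ℕ) < t).image σ) (σ t) =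
      ∏ t ∈ univ.filter (fun t : Fin n => ¬ (t : ℕ) < j),
        ρ ((univ.filter fun i : Fin n => (i : ℕ) < t).image σ') (σ' t) := by
    refine prod_congr rfl fun t ht => ?_
    have hjt : j ≤ (t : ℕ) := not_lt.mp (mem_filter.mp ht).2
    rw [prefix_image_eq_of_eqOn_ge h hjt, h t hjt]
  have hσ := hρ σ
  have hσ' := hρ σ'
  rw [← prod_filter_mul_prod_filter_not univ (fun t : Fin n => (t : ℕ) < j)] at hσ hσ'
  rw [htail] at hσ
  have hne : ∏ t ∈ univ.filter (fun t : Fin n => ¬ (t : ℕ) < j),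
      ρ ((univ.filter fun i : Fin n => (i : ℕ) < t).image σ') (σ' t) ≠ 0 := by
    intro h0
    rw [h0, mul_zero] at hσ'
    exact zero_ne_one hσ'
  exact mul_right_cancel₀ hne (hσ.trans hσ'.symm)

/-- **Path independence.** If all full path products are `1`, the partial path product
`∏_{t < j} ρ (σ({i < t})) (σ t)` depends only on the prefix SET `σ({i < j})`: two orderings with the
same `j`-prefix set are spliced into a third one (the first below `j`, the second from `j` on), to
which both are compared. [folklore] -/
theorem prod_prefix_eq_of_prefix_image_eq (ρ : Finset (Fin n) → Fin n → K)
    (hρ : ∀ σ : Equiv.Perm (Fin n),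
      ∏ t : Fin n, ρ ((univ.filter fun i : Fin n => (i : ℕ) < (t : ℕ)).image σ) (σ t) = 1)
    {σ σ' : Equiv.Perm (Fin n)} {j : ℕ}
    (h : (univ.filter fun i : Fin n => (i : ℕ) < j).image σ =
      (univ.filter fun i : Fin n => (i : ℕ) < j).image σ') :
    ∏ t ∈ univ.filter (fun t : Fin n => (t : ℕ) < j),
        ρ ((univ.filter fun i : Fin n => (i : ℕ) < t).image σ) (σ t) =
      ∏ t ∈ univ.filter (fun t : Fin n => (t : ℕ) < j),
        ρ ((univ.filter fun i : Fin n => (i : ℕ) < t).image σ') (σ' t) := by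
  set f : Fin n → Fin n := fun i => if (i : ℕ) < j then σ' i else σ i with hf_def
  have hcross : ∀ i i' : Fin n, (i : ℕ) < j → ¬ (i' : ℕ) < j → σ' i ≠ σ i' := by
    intro i i' hi hi' hii'
    have hmem : σ i' ∈ (univ.filter fun i : Fin n => (i : ℕ) < j).image σ := by
      rw [h, ← hii']
      exact mem_image_of_mem _ (mem_filter.mpr ⟨mem_univ _, hi⟩)
    rw [mem_prefix_image, Equiv.symm_apply_apply] at hmem
    exact hi' hmem
  have hf : Function.Injective f := by
    intro i i' hii'
    simp only [hf_def] at hii'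
    by_cases hi : (i : ℕ) < j <;> by_cases hi' : (i' : ℕ) < j
    · rw [if_pos hi, if_pos hi'] at hii'
      exact σ'.injective hii'
    · rw [if_pos hi, if_neg hi'] at hii'
      exact absurd hii' (hcross i i' hi hi')
    · rw [if_neg hi, if_pos hi'] at hii'
      exact absurd hii'.symm (hcross i' i hi' hi)
    · rw [if_neg hi, if_neg hi'] at hii'
      exact σ.injective hii'
  set τ : Equiv.Perm (Fin n) := Equiv.ofBijective f (Finite.injective_iff_bijective.mp hf)
    with hτ_def
  have hτlt : ∀ i : Fin n, (i : ℕ) < j → τ i = σ' i := fun i hi => by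
    rw [hτ_def, Equiv.ofBijective_apply, hf_def]
    exact if_pos hi
  have hτge : ∀ i : Fin n, j ≤ (i : ℕ) → τ i = σ i := fun i hi => by
    rw [hτ_def, Equiv.ofBijective_apply, hf_def]
    exact if_neg (not_lt.mpr hi)
  have h1 := prod_prefix_eq_of_eqOn_ge ρ hρ hτge
  have h2 : ∏ t ∈ univ.filter (fun t : Fin n => (t : ℕ) < j),
        ρ ((univ.filter fun i : Fin n => (i : ℕ) < t).image τ) (τ t) =
      ∏ t ∈ univ.filter (fun t : Fin n => (t : ℕ) < j),
        ρ ((univ.filter fun i : Fin n => (i : ℕ) < t).image σ') (σ' t) := by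
    refine prod_congr rfl fun t ht => ?_
    have htj : (t : ℕ) < j := (mem_filter.mp ht).2
    rw [prefix_image_eq_of_eqOn_lt hτlt htj.le, hτlt t htj]
  exact h1.symm.trans h2

/-- Extending a prefix: an ordering whose `|S|`-prefix set is `S` can be modified from position
`|S|` on (by one transposition of positions) so that its next element is any prescribed `k ∉ S`.
[folklore] -/
theorem exists_perm_prefix_image_insert {S : Finset (Fin n)} {σ : Equiv.Perm (Fin n)}
    (hσ : (univ.filter fun i : Fin n => (i : ℕ) < S.card).image σ = S) {k : Fin n} (hk : k ∉ S) :
    ∃ σ' : Equiv.Perm (Fin n), (univ.filter fun i : Fin n => (i : ℕ) < S.card).image σ' = S ∧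
      ∃ hlt : S.card < n, σ' ⟨S.card, hlt⟩ = k := by
  have hlt : S.card < n := by
    -- `Grenet.card_lt_of_notMem` (GrenetEquivariant.lean), kept local to avoid the heavy import
    have h1 : S.card < (insert k S).card := by rw [card_insert_of_notMem hk]; exact Nat.lt_succ_self _
    have h2 : (insert k S).card ≤ n := by simpa using Finset.card_le_univ (insert k S)
    omega
  have hi₀ : S.card ≤ ((σ.symm k : Fin n) : ℕ) := by
    by_contra hle
    have hmem : k ∈ (univ.filter fun i : Fin n => (i : ℕ) < S.card).image σ :=
      (mem_prefix_image σ _ k).mpr (not_le.mp hle)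
    rw [hσ] at hmem
    exact hk hmem
  refine ⟨σ * Equiv.swap (σ.symm k) ⟨S.card, hlt⟩, ?_, hlt, ?_⟩
  · refine (prefix_image_eq_of_eqOn_lt (fun i hi => ?_) le_rfl).trans hσ
    rw [Equiv.Perm.mul_apply, Equiv.swap_apply_of_ne_of_ne]
    · intro hi'
      rw [hi'] at hi
      exact absurd hi (not_lt.mpr hi₀)
    · exact fun hi' => absurd (congrArg Fin.val hi') (ne_of_lt hi)
  · rw [Equiv.Perm.mul_apply, Equiv.swap_apply_right, Equiv.apply_symm_apply]

/-- Every subset `S ⊆ Fin n` is the `|S|`-prefix set of some ordering of `Fin n`. [folklore] -/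
theorem exists_perm_prefix_image_eq (S : Finset (Fin n)) :
    ∃ σ : Equiv.Perm (Fin n), (univ.filter fun i : Fin n => (i : ℕ) < S.card).image σ = S := by
  induction S using Finset.induction_on with
  | empty => exact ⟨1, by simp⟩
  | insert k S hk ih =>
    obtain ⟨σ, hσ⟩ := ih
    obtain ⟨σ', hσ', hlt, hk'⟩ := exists_perm_prefix_image_insert hσ hk
    refine ⟨σ', ?_⟩
    rw [card_insert_of_notMem hk, prefix_image_succ σ' hlt, hk', hσ']

/-- **Potentials (coboundary normal form).** Let `ρ S k` be scalar weights on the arcs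
`S → insert k S` of the subset lattice of `Fin n` such that EVERY full path `∅ → univ` (every
ordering `σ` of `Fin n`) has weight product `∏ₜ ρ (σ({i < t})) (σ t) = 1`. Then there is a
nowhere-vanishing potential `μ` on the subsets with `μ (insert k S) = μ S · ρ S k` for all `k ∉ S`,
i.e. `ρ` is the coboundary `μ(T)/μ(S)`: the diagonal gauge `diag(μ)⁻¹ (1 - A) diag(μ)` then
normalises all arc scalars to `1`.  (`μ S` is the partial path product of any ordering with prefix
set `S`, well defined by `prod_prefix_eq_of_prefix_image_eq`.) [folklore] -/
theorem exists_potential_of_prod_prefix_eq_one (ρ : Finset (Fin n) → Fin n → K)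
    (hρ : ∀ σ : Equiv.Perm (Fin n),
      ∏ t : Fin n, ρ ((univ.filter fun i : Fin n => (i : ℕ) < (t : ℕ)).image σ) (σ t) = 1) :
    ∃ μ : Finset (Fin n) → K, (∀ S, μ S ≠ 0) ∧
      ∀ (S : Finset (Fin n)) (k : Fin n), k ∉ S → μ (insert k S) = μ S * ρ S k := by
  choose enum henum using exists_perm_prefix_image_eq (n := n)
  refine ⟨fun S => ∏ t ∈ univ.filter (fun t : Fin n => (t : ℕ) < S.card),
      ρ ((univ.filter fun i : Fin n => (i : ℕ) < t).image (enum S)) (enum S t), ?_, ?_⟩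
  · intro S h0
    dsimp only at h0
    have h1 := hρ (enum S)
    rw [← prod_filter_mul_prod_filter_not univ (fun t : Fin n => (t : ℕ) < S.card), h0,
      zero_mul] at h1
    exact zero_ne_one h1
  · intro S k hk
    obtain ⟨σ, hσ, hlt, hσk⟩ := exists_perm_prefix_image_insert (henum S) hk
    have hσ1 : (univ.filter fun i : Fin n => (i : ℕ) < (insert k S).card).image σ = insert k S := by
      rw [card_insert_of_notMem hk, prefix_image_succ σ hlt, hσk, hσ]
    dsimp only
    rw [prod_prefix_eq_of_prefix_image_eq ρ hρ ((henum (insert k S)).trans hσ1.symm),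
      prod_prefix_eq_of_prefix_image_eq ρ hρ ((henum S).trans hσ.symm),
      card_insert_of_notMem hk]
    have hsplit : (univ.filter fun t : Fin n => (t : ℕ) < S.card + 1) =
        insert (⟨S.card, hlt⟩ : Fin n) (univ.filter fun t : Fin n => (t : ℕ) < S.card) := by
      ext i
      simp only [mem_filter, mem_univ, true_and, mem_insert, Fin.ext_iff]
      omega
    have hnot : (⟨S.card, hlt⟩ : Fin n) ∉ univ.filter fun t : Fin n => (t : ℕ) < S.card := by
      simp
    have hpre :
        (univ.filter fun i : Fin n => (i : ℕ) < ((⟨S.card, hlt⟩ : Fin n) : ℕ)).image σ = S :=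
      hσ
    rw [hsplit, prod_insert hnot, mul_comm, hpre, hσk]

end Potential

end Grenet

end Literature.Computability.AlgebraicComplexity
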